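import Literature.MathematicalPhysics.QuantumFieldTheory.Balaban1983to89.B9Thm37WholeDir

/-!
# `Balaban1983to89.B9Thm310WholeDir` — Theorem 3.10's algebraic schema `B9Thm310Whole.Identities310` RE-STATED OVER THE DIRECTION LETTERS (R1′-A):
# ★ `Identities310₂` (the Laplacian Leibniz clause `leibL` with `Σ_μ PL_{□,μ}∇_{U,μ}`), `DirLetters310`, `DirSupSq310`, the stacked faces, ★★ `conv3107_of_local3107₂`,
# ★★ `thm310Printed_of_local3107₂`

T. Bałaban, *Propagators for lattice gauge theories in a background field*, Commun. Math. Phys. **99** (1985) 389–434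
[`Balaban1985BackgroundPropagators`, "B9"], Thm 3.10 (3.105)–(3.108) pp. 414–416, (3.100) p. 413, (3.87) p. 409, (3.42) p. 397, (3.35) p. 396, Cor. 3.6 p. 408;
T. Bałaban, *Propagators and renormalization transformations for lattice gauge theories. II*, Commun. Math. Phys. **96** (1984) 223–250
[`Balaban1984PropagatorsII`, "[4]"], (2.39)–(2.44) pp. 229–230, (2.51) p. 232, Lemma 2.1 (2.61) p. 234, Prop. 2.2 (2.64)–(2.67) p. 234.

statement-level skeleton of published theorems with citation tags; proofs where landed; nothing here is a claim about the
Yang–Mills mass gap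

WHY THIS FILE (cell `pub-ymgap`, Track A node N06 [B9], row 19; seat `pub-ymgap-dag-n06-c` g10, LOCATED-9 bus l.32219).  node00-def-Y's OBS-2 «slice
obstruction» (bus l.29166) shows that an identity with a `Y → X` letter composed AFTER the certificate's slice-wise derivative `D` cannot be
instantiated with level-uniform sizes; the pin owner's ruling R1′ (l.29454) moved Theorem 3.7's three such clauses to the per-direction letters
(`B9Thm37WholeDir.Identities₂`, landed).  Theorem 3.10's schema `Identities310` has exactly ONE clause of that shape — the Laplacian Leibniz rule
`leibL : Δ_U∘M_h = M_h∘Δ_U + (PL_□ ∘ D + CL_□)` — read by exactly ONE line of the engine (`conv3107_of_local3107`, entry 4).  Here: the clause over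
the direction letters (`Identities310₂`), the per-direction entry transfer `DirSupSq310`, and the two theorems re-threaded; entry 4 is read at the
STACKED letters (`B9Thm37WholeDir.stackDir ∕ costackDir`) through the generic v1 cube lemma, so constants and located numerics are byte-identical.

HONEST SCOPE.  A hypothesis schema + bookkeeping; «Cor. 3.6 for the G_□», the factor bounds, the structure identities are HYPOTHESES; nothing of [B9]
asserted; COUNT-NEUTRAL; N06 NOT discharged; one finite lattice programme — nothing continuum, nothing about OS positivity or the mass gap.
-/

namespace Literature.MathematicalPhysics.QuantumFieldTheory.Balaban1983to89.B9Thm310WholeDir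

open Finset B6RandomWalk B6RandomWalkHom B9Thm37Sum B9Thm34Ext B9Thm37Glue B9Thm37Whole B9Cor38Whole B9Thm310Whole
open B9RWSums346SecondDiff B9RWSums346SecondDiffGp B9Thm37WholeDir

noncomputable section

/-! ## §1 The schema over the direction letters, the entry transfer, the stacked faces -/

section OneMember

variable {g : B9.Geometry} [Fintype g.Site] [DecidableEq g.Site] {B : B9.Backgrounds} {X Y ι A Dir : Type}

/-- **THE PER-DIRECTION LAPLACIAN-LEIBNIZ LETTER OF THEOREM 3.10** — `PL_{□,μ}(U)` with `Δ_U M_{h_□} = M_{h_□}Δ_U + (Σ_μ PL_{□,μ}∇_{U,μ} + CL_□)`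
((3.100) p. 413; [4] (2.39) p. 229 read for G), and its kernel letters `KPLd` summing below the `Ops310` kernel `KPL` — the A-side twin of
`B9Thm37WholeDir.DirLetters37` (only the `PL` component is needed: `Identities310` has no `P∘D ∕ Dstar∘Pt` K-letter, (3.105) reads the factor
letters `Rf ∕ Rt`).  A LETTER RECORD; nothing asserted. [cite: Balaban1985BackgroundPropagators, (3.100) p.413 + (3.105) p.414; Balaban1984PropagatorsII, (2.39) p.229] -/
structure DirLetters310 (𝔬 : Ops310 g B X Y ι A) (Dir : Type) where
  PLd : B.Cfg → ι → Dir → Module.End ℝ (X → ℝ)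
  KPLd : ι → Dir → g.Site → g.Site → ℝ

/-- ★ **`Identities310₂` — THE ALGEBRAIC STRUCTURE OF THE EXPANSION (3.105)–(3.107) AT U, THE LAPLACIAN LEIBNIZ RULE READ OVER THE DIRECTION LETTERS
(R1′-A).**  `B9Thm310Whole.Identities310` VERBATIM except the one clause hit by node00-def-Y's «slice obstruction» (OBS-2, bus l.29166): `leibL` is
stated with the per-direction K-letter `Σ_μ PL_{□,μ} * ∇_{U,μ}` (`𝔡.Dd U μ`, the direction letters the certificate already pins) instead of `PL_□ ∘ D`
after the slice-wise `D`, its majorants per direction (`hPL`) with kernels summing below `KPL` (`KPLd_sum`, so `StaticOK310 ∕ Sizes310` and every located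
numeric are byte-identical).  `hPD hCD hCL hCLt leibD leibT inv invT eq3105 eq3105T` verbatim.  A HYPOTHESIS SCHEMA; nothing asserted.
[cite: Balaban1985BackgroundPropagators, (3.105)–(3.106) p.414 + (3.87) p.409 + (3.100) p.413 + (3.27) p.395; Balaban1984PropagatorsII, (2.39)–(2.44) pp.229–230] -/
structure Identities310₂ [Fintype A] [Fintype ι] [Fintype Dir] (𝔬 : Ops310 g B X Y ι A) (𝔡 : DirOps310 𝔬 Dir) (𝔩 : DirLetters310 𝔬 Dir)
    (R : ℝ) (H : Prop) (U : B.Cfg) : Prop where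
  hPD : ∀ i, HasMajorantHom (g := toB6 g R H) 𝔬.blkY 𝔬.blkY (𝔬.PD U i) (𝔬.KPD i)
  hCD : ∀ i, HasMajorantHom (g := toB6 g R H) 𝔬.blk 𝔬.blkY (𝔬.CD U i) (𝔬.KCD i)
  hPL : ∀ i μ, HasMajorant (g := toB6 g R H) 𝔬.blk (𝔩.PLd U i μ) (𝔩.KPLd i μ)
  KPLd_sum : ∀ i (a b : g.Site), (∑ μ, 𝔩.KPLd i μ a b) ≤ 𝔬.KPL i a b
  hCL : ∀ i, HasMajorantHom (g := toB6 g R H) 𝔬.blk 𝔬.blk (𝔬.CL U i) (𝔬.KCL i)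
  hCLt : ∀ i, HasMajorantHom (g := toB6 g R H) 𝔬.blkY 𝔬.blk (𝔬.CLt U i) (𝔬.KCLt i)
  leibD : ∀ i, 𝔬.D U ∘ₗ mulOp (𝔬.h i) = mulOp (𝔬.hY i) ∘ₗ 𝔬.D U + (𝔬.PD U i ∘ₗ 𝔬.D U + 𝔬.CD U i)
  leibL : ∀ i, 𝔬.Lap U ∘ₗ mulOp (𝔬.h i) = mulOp (𝔬.h i) ∘ₗ 𝔬.Lap U + ((∑ μ, 𝔩.PLd U i μ * 𝔡.Dd U μ) + 𝔬.CL U i)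
  leibT : ∀ i, mulOp (𝔬.h i) ∘ₗ 𝔬.Dstar U = 𝔬.Dstar U ∘ₗ mulOp (𝔬.hY i) + 𝔬.CLt U i
  inv : 𝔬.G U * 𝔬.Δa U = 1
  invT : 𝔬.Δa U * 𝔬.G U = 1
  eq3105 : 𝔬.Δa U * (∑ i, mulOp (𝔬.h i) * 𝔬.Gsq U i * mulOp (𝔬.h i)) = 1 - ∑ a, 𝔬.Rf U a
  eq3105T : (∑ i, mulOp (𝔬.h i) * 𝔬.Gsq U i * mulOp (𝔬.h i)) * 𝔬.Δa U = 1 - ∑ a, 𝔬.Rt U a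

/-- **THE PER-DIRECTION (3.42)₂ ENTRY TRANSFER FOR THE LOCAL OPERATORS G_□(U)** (A-side twin of `B9Thm37WholeDir.DirSupSq37`): the two-space entry
`∇_UG_□` ∕ `G_□∇\*_U` of `Local342G` yields each per-direction entry `∇_{U,μ}G_□` ∕ `G_□∇\*_{U,μ}` with the same majorant (at the pins: the slice
relabelling of n06-w5's `B9DirSupAtPins`).  A HYPOTHESIS SCHEMA about the letters; nothing asserted. [cite: Balaban1985BackgroundPropagators, (3.42) p.397 + (3.3) p.390 + Cor. 3.6 p.408] -/
structure DirSupSq310 [Fintype X] [Fintype Y] (𝔬 : Ops310 g B X Y ι A) (𝔡 : DirOps310 𝔬 Dir) (R : ℝ) (H : Prop) (U : B.Cfg) : Prop where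
  left : ∀ i (m : g.Site → g.Site → ℝ), HasMajorantHom (g := toB6 g R H) 𝔬.blk 𝔬.blkY (𝔬.D U ∘ₗ 𝔬.Gsq U i) m →
    ∀ μ : Dir, HasMajorant (g := toB6 g R H) 𝔬.blk (𝔡.Dd U μ ∘ₗ 𝔬.Gsq U i) m
  right : ∀ i (m : g.Site → g.Site → ℝ), HasMajorantHom (g := toB6 g R H) 𝔬.blkY 𝔬.blk (𝔬.Gsq U i ∘ₗ 𝔬.Dstar U) m →
    ∀ μ : Dir, HasMajorant (g := toB6 g R H) 𝔬.blk (𝔬.Gsq U i ∘ₗ 𝔡.Dsd U μ) m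

section Stacked

variable [Fintype A] [Fintype ι] [Fintype Dir] {𝔬 : Ops310 g B X Y ι A} {𝔡 : DirOps310 𝔬 Dir} {𝔩 : DirLetters310 𝔬 Dir}
  {R : ℝ} {H : Prop} {U : B.Cfg}

omit [DecidableEq g.Site] in
/-- the v1 projection: forgetting the Laplacian-Leibniz clause, `Identities310₂` still gives (3.105)∕(3.106) and the other Leibniz rules — the G-side member
faces of the lineage read only `inv ∕ invT ∕ eq3105 ∕ eq3105T`. [cite: Balaban1985BackgroundPropagators, (3.105)–(3.106) p.414] -/
theorem Identities310₂.fixedPoint [Fintype X] [DecidableEq X] (hI : Identities310₂ 𝔬 𝔡 𝔩 R H U) :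
    𝔬.G U = (∑ i, mulOp (𝔬.h i) * 𝔬.Gsq U i * mulOp (𝔬.h i)) + 𝔬.G U * ∑ a, 𝔬.Rf U a :=
  fixedPoint_of_388 hI.inv hI.eq3105

omit [DecidableEq g.Site] in
/-- ★ **the stacked Laplacian-Leibniz rule**: `Δ_U ∘ M_h = M_h ∘ Δ_U + (costackDir PL_{□,·} ∘ₗ stackDir ∇_{U,·} + CL_□)` — LITERALLY v1's `hLeib` of
`B9Thm37Glue.leftEntry_cube_majorant` at the two-space letter `Y′ := X × Dir`. [cite: Balaban1985BackgroundPropagators, (3.100) p.413; Balaban1984PropagatorsII, (2.39) p.229] -/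
theorem Identities310₂.leibL_stacked (hI : Identities310₂ 𝔬 𝔡 𝔩 R H U) (i : ι) :
    𝔬.Lap U ∘ₗ mulOp (𝔬.h i) = mulOp (𝔬.h i) ∘ₗ 𝔬.Lap U + (costackDir (𝔩.PLd U i) ∘ₗ stackDir (𝔡.Dd U) + 𝔬.CL U i) := by
  rw [costackDir_comp_stackDir]; exact hI.leibL i

omit [DecidableEq g.Site] in
/-- ★ **the stacked `PL`-letter has the `Ops310` kernel `KPL i` as its two-space majorant** (per-direction majorants + `KPLd_sum`; no `#Dir` factor).
[cite: Balaban1984PropagatorsII, (2.39)–(2.40) pp.229–230 + (2.51) p.232] -/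
theorem Identities310₂.hasMajorantHom_costackPL (hI : Identities310₂ 𝔬 𝔡 𝔩 R H U) (i : ι) :
    HasMajorantHom (g := toB6 g R H) (fun p : X × Dir => 𝔬.blk p.1) 𝔬.blk (costackDir (𝔩.PLd U i)) (𝔬.KPL i) :=
  hasMajorantHom_mono (g := toB6 g R H) _ _ (hasMajorantHom_costackDir R H 𝔬.blk (𝔩.PLd U i) (𝔩.KPLd i) (hI.hPL i))
    fun a b => hI.KPLd_sum i a b

omit [DecidableEq g.Site] [Fintype A] [Fintype ι] in
/-- ★ **the stacked gradient of G_□ has the (3.42)₂ entry majorant** (from the v1 two-space entry by `DirSupSq310.left`). [cite: Balaban1985BackgroundPropagators, (3.42) p.397 + Cor. 3.6 p.408] -/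
theorem DirSupSq310.hasMajorantHom_stackDd [Fintype X] [Fintype Y] (hT : DirSupSq310 𝔬 𝔡 R H U) (i : ι) (m : g.Site → g.Site → ℝ)
    (h2 : HasMajorantHom (g := toB6 g R H) 𝔬.blk 𝔬.blkY (𝔬.D U ∘ₗ 𝔬.Gsq U i) m) :
    HasMajorantHom (g := toB6 g R H) 𝔬.blk (fun p : X × Dir => 𝔬.blk p.1) (stackDir (𝔡.Dd U) ∘ₗ 𝔬.Gsq U i) m := by
  have hμ := hT.left i m h2
  intro y' f B hf p
  exact hμ p.2 y' f B hf p.1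

end Stacked

/-! ## §2 Theorem 3.10 at one member and one U over the direction letters -/

variable [Fintype Dir]

omit [Fintype g.Site] [DecidableEq g.Site] in
/-- Arithmetic of «M sufficiently large»: a constant A(1 − q)⁻¹ with q ≦ ½ and A ≦ A′ is ≦ 2A′, against nonnegative weights
and a larger exponential factor (verbatim twin of the private lemma of `B9Thm37Whole`). [folklore] -/
private theorem weaken' {A A' q w e e' : ℝ} (hA : 0 ≤ A) (hAA' : A ≤ A') (hq : q ≤ 1 / 2) (hw : 0 ≤ w) (he : 0 ≤ e)
    (hee' : e ≤ e') : A * (1 - q)⁻¹ * w * e ≤ 2 * A' * w * e' := by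
  have hinv : (1 - q)⁻¹ ≤ 2 := by
    rw [inv_le_comm₀ (by linarith) (by norm_num : (0 : ℝ) < 2)]
    linarith
  have h1 : A * (1 - q)⁻¹ ≤ 2 * A' :=
    calc A * (1 - q)⁻¹ ≤ A * 2 := mul_le_mul_of_nonneg_left hinv hA
      _ ≤ A' * 2 := mul_le_mul_of_nonneg_right hAA' (by norm_num)
      _ = 2 * A' := by ring
  have hA' : 0 ≤ 2 * A' := by linarith
  calc A * (1 - q)⁻¹ * w * e = (A * (1 - q)⁻¹) * (w * e) := by ring
    _ ≤ (2 * A') * (w * e') :=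
        mul_le_mul h1 (mul_le_mul_of_nonneg_left hee' hw) (mul_nonneg hw he) hA'
    _ = 2 * A' * w * e' := by ring

omit [Fintype g.Site] [DecidableEq g.Site] in
/-- Monotonicity of the entry constants B₀(N + N′e^{δ₀ρ}s)c₁ in the size letter s. [folklore] -/
private theorem constA_le' {B₀ N N' ex s t c : ℝ} (hB₀ : 0 ≤ B₀) (hN'e : 0 ≤ N' * ex) (hc : 0 ≤ c) (hst : s ≤ t) :
    B₀ * (N + N' * ex * s) * c ≤ B₀ * (N + N' * ex * t) * c := by
  have h1 : N' * ex * s ≤ N' * ex * t := mul_le_mul_of_nonneg_left hst hN'e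
  have h2 : N + N' * ex * s ≤ N + N' * ex * t := by linarith
  exact mul_le_mul_of_nonneg_right (mul_le_mul_of_nonneg_left h2 hB₀) hc

/-- **(v2 OVER THE DIRECTION LETTERS, R1′-A: `B9Thm310Whole.conv3107_of_local3107` with `Identities310₂` + `DirSupSq310`; ONLY entry 4's Leibniz step changes — it is read at the
stacked letters through the generic `B9Thm37Glue.leftEntry_cube_majorant` at `Y′ := X × Dir`; constants and every other line VERBATIM.) THEOREM 3.10 AT ONE MEMBER AND ONE CONFIGURATION U — the four entries of (3.42) for the sum G(U) of (3.107) with ONE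
pair of constants** (C = `B9Thm37Whole.const37 d δ₀ α ρ B₀ N N' Cℓ K` = 2B₀(N + N′e^{δ₀ρ}C_ℓK)c₁(α), δ = (1 − 2α)δ₀), glued
from the lineage: G = G₀ + GR (`B9Thm37Sum.fixedPoint_of_388` on `GΔ_a = I`, (3.105)) resp. G = G₀ + R♯G (the transposed
(3.105), `B9Thm37Glue.fixedPoint_of_388T`); entry 1 by `B6RandomWalk.majorant_of_fixedPoint_266` over the localized legs
h_□G_□h_□ (`B9Thm37Sum.hasMajorant_sandwich_local`); entries 2, 4 by `B6RandomWalkHom.hom_majorant_of_fixedPoint_266` over the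
legs `B9Thm37Glue.leftEntry_cube_majorant` (E = ∇_U, W = L^jη; E = Δ_U, W ≡ 1); entry 3 by
`B6RandomWalkHom.hom_majorant_of_leftFixedPoint_weighted` over `B9Thm37Glue.rightEntry_cube_majorant` and the scale-weighted
transposed factors; the factors summed with the overlap count N_F (`B9Thm37Sum.hasMajorant_localSum`).  Inputs: «Cor. 3.6 for
all G_□(U)» (`Local342G`), the (3.89)-type factor bounds (`Factors389`), the structure (`Identities310`), the static data
(`StaticOK310`), [4] Lemma 2.1 (2.61) at the exponent α, and «M sufficiently large» LOCATED as N_F·θ₀M⁻¹·c₁(α) ≦ ½ with the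
Leibniz sizes ≦ K (C_ℓ ≧ 1, 0 ≦ α ≦ ½).  p. 416: *"From (3.108) it follows that the expansion (3.107) is convergent in all
norms in the inequalities (3.42)–(3.47)."* [cite: Balaban1985BackgroundPropagators, Thm 3.10 (3.105)–(3.108) pp.414–416 + (3.42) p.397; Balaban1984PropagatorsII, Prop 2.2 (2.64)–(2.67) p.234] -/
theorem conv3107_of_local3107₂ [Fintype X] [DecidableEq X] [Fintype Y] [DecidableEq Y] [Fintype ι] [Fintype A]
    (𝔬 : Ops310 g B X Y ι A) (𝔡 : DirOps310 𝔬 Dir) (𝔩 : DirLetters310 𝔬 Dir) (R : ℝ) (H : Prop) (d : ℕ) (δ₀ α ρ B₀ N N' NF Cℓ K θ₀ : ℝ) (κ : Sizes310) (U : B.Cfg)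
    (hB₀ : 0 ≤ B₀) (hδ₀ : 0 ≤ δ₀) (hα : 0 ≤ α) (hα2 : α ≤ 1 / 2) (hN : 0 ≤ N) (hN' : 0 ≤ N') (hNF : 0 ≤ NF)
    (hCℓ : 1 ≤ Cℓ) (hK : 0 ≤ K) (hθ₀ : 0 ≤ θ₀) (hM : 0 < g.M) (hs : StaticOK310 𝔬 ρ N N' NF Cℓ κ) (hκ : κ.Bounded K)
    (h261 : Ineq261 d (toB6 g R H) δ₀ α) (hq : NF * (θ₀ * g.M⁻¹) * B6.c1 d δ₀ α ≤ 1 / 2)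
    (hl : Local342G 𝔬 R H B₀ δ₀ U) (hf : Factors389 𝔬 R H θ₀ δ₀ U) (hTd : DirSupSq310 𝔬 𝔡 R H U)
    (hi : Identities310₂ 𝔬 𝔡 𝔩 R H U) :
    Conv3107 𝔬 R H (const37 d δ₀ α ρ B₀ N N' Cℓ K) ((1 - 2 * α) * δ₀) U := by
  have hlen : ∀ y : g.Site, 0 ≤ g.len y := fun y => (hs.lenpos y).le
  have h1αδ : 0 ≤ (1 - α) * δ₀ := mul_nonneg (by linarith) hδ₀
  have hαδ : 0 ≤ α * δ₀ := mul_nonneg hα hδ₀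
  have hαδ2 : 0 ≤ (1 - 2 * α) * δ₀ := mul_nonneg (by linarith) hδ₀
  have htri : Triangle254 (toB6 g R H) := fun a b c => hs.tri a b c
  have h263 : Ineq263 d (toB6 g R H) δ₀ α := ineq263_of_261 d (toB6 g R H) δ₀ α htri hδ₀ (by linarith) h261
  have hc1 : 0 ≤ B6.c1 d δ₀ α := c1_nonneg d δ₀ α
  have hCℓ0 : 0 ≤ Cℓ := le_trans zero_le_one hCℓ
  have hθ : 0 ≤ NF * (θ₀ * g.M⁻¹) := mul_nonneg hNF (mul_nonneg hθ₀ (inv_nonneg.mpr hM.le))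
  have hθM : 0 ≤ θ₀ * g.M⁻¹ := mul_nonneg hθ₀ (inv_nonneg.mpr hM.le)
  have hsmall : NF * (θ₀ * g.M⁻¹) * B6.c1 d δ₀ α < 1 := by linarith
  have hN'e : 0 ≤ N' * Real.exp (δ₀ * ρ) := mul_nonneg hN' (Real.exp_nonneg _)
  have hkD : 0 ≤ κ.kPD + κ.kCD := add_nonneg hκ.nonneg.kPD hκ.nonneg.kCD
  have hkL : 0 ≤ κ.kPL + κ.kCL := add_nonneg hκ.nonneg.kPL hκ.nonneg.kCL
  have hKCℓ : K ≤ Cℓ * K := by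
    calc K = 1 * K := (one_mul K).symm
      _ ≤ Cℓ * K := mul_le_mul_of_nonneg_right hCℓ hK
  have hexp : ∀ a b : g.Site, Real.exp (-((1 - α) * δ₀ * g.dist a b)) ≤ Real.exp (-((1 - 2 * α) * δ₀ * g.dist a b)) := by
    intro a b
    have h0 : 0 ≤ α * δ₀ * g.dist a b := mul_nonneg hαδ (hs.dnn a b)
    exact Real.exp_le_exp.mpr (by nlinarith [h0])
  have hfin : ∀ w e' : ℝ, 2 * (B₀ * (N + N' * Real.exp (δ₀ * ρ) * (Cℓ * K)) * B6.c1 d δ₀ α) * w * e' =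
      const37 d δ₀ α ρ B₀ N N' Cℓ K * w * e' := by
    intro w e'
    simp only [const37]
    ring
  -- R = Σ_a R_a has majorant N_F·θ₀M⁻¹·e^{−δ₀d} (the factor bounds summed with the overlap count N_F)
  have hRa : ∀ a : A, HasMajorant (g := toB6 g R H) 𝔬.blk (𝔬.Rf U a)
      (fun (y y' : g.Site) => (if y ∈ 𝔬.SF a then (1 : ℝ) else 0) * (θ₀ * g.M⁻¹ * Real.exp (-(δ₀ * g.dist y y')))) :=
    fun a => hasMajorant_mono (g := toB6 g R H) 𝔬.blk (hf.fac a) fun y y' => le_of_eq (by split_ifs <;> simp)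
  have hR : HasMajorant (g := toB6 g R H) 𝔬.blk (∑ a, 𝔬.Rf U a)
      (fun (y y' : g.Site) => NF * (θ₀ * g.M⁻¹) * Real.exp (-(δ₀ * g.dist y y'))) := by
    have hloc := hasMajorant_localSum (G := toB6 g R H) 𝔬.blk (fun a => 𝔬.Rf U a)
      (fun a (y : g.Site) => if y ∈ 𝔬.SF a then (1 : ℝ) else 0)
      (fun (y y' : g.Site) => θ₀ * g.M⁻¹ * Real.exp (-(δ₀ * g.dist y y'))) NF
      (fun y y' => mul_nonneg hθM (Real.exp_nonneg _)) hRa hs.cntF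
    exact hasMajorant_mono (g := toB6 g R H) 𝔬.blk hloc fun y y' => le_of_eq (by ring)
  -- (3.106): G = G₀ + GR from GΔ_a = I and (3.105)
  have hfix : 𝔬.G U = (∑ i, mulOp (𝔬.h i) * 𝔬.Gsq U i * mulOp (𝔬.h i)) + 𝔬.G U * ∑ a, 𝔬.Rf U a :=
    fixedPoint_of_388 hi.inv hi.eq3105
  -- entry 1: the head terms h_□G_□h_□ localized by Cor. 3.6 entry 1, summed with the overlap count N
  have hT : ∀ i, HasMajorant (g := toB6 g R H) 𝔬.blk (mulOp (𝔬.h i) * 𝔬.Gsq U i * mulOp (𝔬.h i))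
      (fun (a b : g.Site) => (if a ∈ 𝔬.S i then (1 : ℝ) else 0) * (B₀ * g.len a ^ 2 * Real.exp (-(δ₀ * g.dist a b)))) :=
    fun i => hasMajorant_mono (g := toB6 g R H) 𝔬.blk
      (hasMajorant_sandwich_local (R := R) (H := H) 𝔬.blk (hl.e0 i) (𝔬.h i) (hs.hh i) (𝔬.S i) (hs.hS i))
      fun a b => le_of_eq (by split_ifs <;> simp)
  have hG0 : HasMajorant (g := toB6 g R H) 𝔬.blk (∑ i, mulOp (𝔬.h i) * 𝔬.Gsq U i * mulOp (𝔬.h i))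
      (fun (a b : g.Site) => N * B₀ * g.len a ^ 2 * Real.exp (-(δ₀ * g.dist a b))) := by
    have hloc := hasMajorant_localSum (G := toB6 g R H) 𝔬.blk (fun i => mulOp (𝔬.h i) * 𝔬.Gsq U i * mulOp (𝔬.h i))
      (fun i (a : g.Site) => if a ∈ 𝔬.S i then (1 : ℝ) else 0)
      (fun (a b : g.Site) => B₀ * g.len a ^ 2 * Real.exp (-(δ₀ * g.dist a b))) N
      (fun a b => mul_nonneg (mul_nonneg hB₀ (sq_nonneg _)) (Real.exp_nonneg _)) hT hs.cnt
    exact hasMajorant_mono (g := toB6 g R H) 𝔬.blk hloc fun a b => le_of_eq (by ring)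
  have e1 := majorant_of_fixedPoint_266 (g := toB6 g R H) 𝔬.blk d δ₀ α (NF * (θ₀ * g.M⁻¹)) (N * B₀)
    (fun a => g.len a ^ 2) (mul_nonneg hN hB₀) (fun a => sq_nonneg _) hθ h1αδ htri hs.refl hs.dnn h261 h263 hsmall
    hG0 hR hfix
  -- entries 2 and 4: the left legs E(h_□G_□h_□) by the Leibniz rules, summed, then the two-space Neumann series
  have leftSum : ∀ {Z : Type} [Fintype Z] [DecidableEq Z] (blkZ : Z → g.Site) (E : (X → ℝ) →ₗ[ℝ] (Z → ℝ))
      (W : g.Site → ℝ) (s : ℝ), (∀ y, 0 ≤ W y) → 0 ≤ s →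
      (∀ i, HasMajorantHom (g := toB6 g R H) 𝔬.blk blkZ (E ∘ₗ (mulOp (𝔬.h i) * 𝔬.Gsq U i * mulOp (𝔬.h i)))
        (fun (a b : g.Site) => ((if a ∈ 𝔬.S i then (1 : ℝ) else 0) * (B₀ * W a) +
          (if a ∈ 𝔬.S' i then (1 : ℝ) else 0) * (B₀ * Real.exp (δ₀ * ρ) * s * W a)) * Real.exp (-(δ₀ * g.dist a b)))) →
      HasMajorantHom (g := toB6 g R H) 𝔬.blk blkZ (E ∘ₗ 𝔬.G U)
        (fun (a b : g.Site) => B₀ * (N + N' * Real.exp (δ₀ * ρ) * s) * B6.c1 d δ₀ α *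
          (1 - NF * (θ₀ * g.M⁻¹) * B6.c1 d δ₀ α)⁻¹ * W a * Real.exp (-((1 - α) * δ₀ * g.dist a b))) := by
    intro Z _ _ blkZ E W s hW hs0 hcube
    have hA : 0 ≤ B₀ * (N + N' * Real.exp (δ₀ * ρ) * s) := mul_nonneg hB₀ (add_nonneg hN (mul_nonneg hN'e hs0))
    have hsumE : E ∘ₗ (∑ i, mulOp (𝔬.h i) * 𝔬.Gsq U i * mulOp (𝔬.h i)) =
        ∑ i, E ∘ₗ (mulOp (𝔬.h i) * 𝔬.Gsq U i * mulOp (𝔬.h i)) := by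
      apply LinearMap.ext
      intro μ
      rw [LinearMap.comp_apply, LinearMap.sum_apply, LinearMap.sum_apply, map_sum]
      rfl
    have hS₀ : HasMajorantHom (g := toB6 g R H) 𝔬.blk blkZ (E ∘ₗ ∑ i, mulOp (𝔬.h i) * 𝔬.Gsq U i * mulOp (𝔬.h i))
        (fun (a b : g.Site) => B₀ * (N + N' * Real.exp (δ₀ * ρ) * s) * W a * Real.exp (-(δ₀ * g.dist a b))) := by
      rw [hsumE]
      refine hasMajorantHom_mono (g := toB6 g R H) 𝔬.blk blkZ
        (hasMajorantHom_fintypeSum 𝔬.blk blkZ (fun i => E ∘ₗ (mulOp (𝔬.h i) * 𝔬.Gsq U i * mulOp (𝔬.h i))) _ hcube)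
        fun a b => ?_
      have h1 : 0 ≤ B₀ * W a := mul_nonneg hB₀ (hW a)
      have h2 : 0 ≤ B₀ * Real.exp (δ₀ * ρ) * s * W a :=
        mul_nonneg (mul_nonneg (mul_nonneg hB₀ (Real.exp_nonneg _)) hs0) (hW a)
      calc (∑ i, ((if a ∈ 𝔬.S i then (1 : ℝ) else 0) * (B₀ * W a) +
              (if a ∈ 𝔬.S' i then (1 : ℝ) else 0) * (B₀ * Real.exp (δ₀ * ρ) * s * W a)) *
              Real.exp (-(δ₀ * g.dist a b)))
          = ((∑ i, if a ∈ 𝔬.S i then (1 : ℝ) else 0) * (B₀ * W a) +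
              (∑ i, if a ∈ 𝔬.S' i then (1 : ℝ) else 0) * (B₀ * Real.exp (δ₀ * ρ) * s * W a)) *
              Real.exp (-(δ₀ * g.dist a b)) := by
            simp only [Finset.sum_mul, add_mul, Finset.sum_add_distrib]
        _ ≤ (N * (B₀ * W a) + N' * (B₀ * Real.exp (δ₀ * ρ) * s * W a)) * Real.exp (-(δ₀ * g.dist a b)) :=
            mul_le_mul_of_nonneg_right (add_le_add (mul_le_mul_of_nonneg_right (hs.cnt a) h1)
              (mul_le_mul_of_nonneg_right (hs.cnt' a) h2)) (Real.exp_nonneg _)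
        _ = B₀ * (N + N' * Real.exp (δ₀ * ρ) * s) * W a * Real.exp (-(δ₀ * g.dist a b)) := by ring
    have hmain := hom_majorant_of_fixedPoint_266 (g := toB6 g R H) 𝔬.blk blkZ d δ₀ α (NF * (θ₀ * g.M⁻¹))
      (B₀ * (N + N' * Real.exp (δ₀ * ρ) * s)) W hA hW hθ h1αδ htri hs.refl hs.dnn h261 h263 hsmall hS₀ hR
      (leftEntry_fixpoint E hfix)
    exact hasMajorantHom_mono (g := toB6 g R H) 𝔬.blk blkZ hmain fun a b => le_of_eq (by simp only [toB6_dist])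
  have e2 := leftSum 𝔬.blkY (𝔬.D U) (fun y => g.len y) (κ.kPD + κ.kCD) hlen hkD fun i =>
    leftEntry_cube_majorant 𝔬.blk 𝔬.blkY 𝔬.blkY δ₀ ρ B₀ κ.kPD κ.kCD (fun y => g.len y) (𝔬.S i) (𝔬.S' i) (𝔬.h i)
      (𝔬.hY i) (𝔬.KPD i) (𝔬.KCD i) hB₀ hδ₀ htri hlen (hs.hh i) (hs.hhY i) (hs.hSY i) (hs.KPD_nonneg i) (hs.KPD_loc i)
      (hs.KPD_row i) (hs.KCD_nonneg i) (hs.KCD_loc i) (hs.KCD_row i) (hl.e0 i) (hl.e1 i) (hl.e1 i) (hi.hPD i) (hi.hCD i)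
      (hi.leibD i)
  have e4 := leftSum 𝔬.blk (𝔬.Lap U) (fun _ => (1 : ℝ)) (κ.kPL + κ.kCL) (fun _ => zero_le_one) hkL fun i =>
    -- v2: entry 4's Leibniz K-letter `Σ_μ PL_{□,μ}∇_{U,μ}` at the STACKED letters `D′ := stackDir ∇_{U,·}` (entry from `DirSupSq310`),
    -- `PL′ := costackDir PL_{□,·}` (kernel `KPL` by `KPLd_sum`) over `Y′ := X × Dir` — the generic v1 cube lemma, same constants
    leftEntry_cube_majorant 𝔬.blk (fun p : X × Dir => 𝔬.blk p.1) 𝔬.blk δ₀ ρ B₀ κ.kPL κ.kCL (fun _ => (1 : ℝ)) (𝔬.S i) (𝔬.S' i)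
      (𝔬.h i) (𝔬.h i) (𝔬.KPL i) (𝔬.KCL i) hB₀ hδ₀ htri hlen (hs.hh i) (hs.hh i) (hs.hS i) (hs.KPL_nonneg i) (hs.KPL_loc i)
      (fun a => by simpa only [mul_one] using hs.KPL_row i a) (hs.KCL_nonneg i) (hs.KCL_loc i)
      (fun a => by simpa only [mul_one] using hs.KCL_row i a) (hl.e0 i) (hTd.hasMajorantHom_stackDd i _ (hl.e1 i))
      (hasMajorantHom_mono (g := toB6 g R H) 𝔬.blk 𝔬.blk (hl.e3 i) fun a b => by simp only [mul_one, le_refl])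
      (hi.hasMajorantHom_costackPL i) (hi.hCL i) (hi.leibL_stacked i)
  -- entry 3: the right legs h_□G_□h_□∇*_U by the right Leibniz rule, the transposed factors, the weighted left fixed point
  have hcube3 : ∀ i, HasMajorantHom (g := toB6 g R H) 𝔬.blkY 𝔬.blk ((mulOp (𝔬.h i) * 𝔬.Gsq U i * mulOp (𝔬.h i)) ∘ₗ 𝔬.Dstar U)
      (fun (a b : g.Site) => ((if a ∈ 𝔬.S i then (1 : ℝ) else 0) * (B₀ * g.len a) +
        (if b ∈ 𝔬.S' i then (1 : ℝ) else 0) * (B₀ * Real.exp (δ₀ * ρ) * Cℓ * κ.kCLt * g.len a)) *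
        Real.exp (-(δ₀ * g.dist a b))) := fun i =>
    rightEntry_cube_majorant 𝔬.blk 𝔬.blkY δ₀ ρ B₀ κ.kCLt Cℓ (𝔬.S i) (𝔬.S' i) (𝔬.h i) (𝔬.hY i) (𝔬.KCLt i) hB₀ hδ₀
      hκ.nonneg.kCLt hCℓ0 htri hs.lenpos (hs.hh i) (hs.hS i) (hs.hhY i) (hs.comp i) (hs.KCLt_nonneg i) (hs.KCLt_loc i)
      (hs.KCLt_col i) (hl.e0 i) (hl.e2 i) (hi.hCLt i) (hi.leibT i)
  have hsumD : (∑ i, mulOp (𝔬.h i) * 𝔬.Gsq U i * mulOp (𝔬.h i)) ∘ₗ 𝔬.Dstar U =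
      ∑ i, (mulOp (𝔬.h i) * 𝔬.Gsq U i * mulOp (𝔬.h i)) ∘ₗ 𝔬.Dstar U := by
    apply LinearMap.ext
    intro μ
    simp only [LinearMap.comp_apply, LinearMap.sum_apply]
  have hT₀ : HasMajorantHom (g := toB6 g R H) 𝔬.blkY 𝔬.blk ((∑ i, mulOp (𝔬.h i) * 𝔬.Gsq U i * mulOp (𝔬.h i)) ∘ₗ 𝔬.Dstar U)
      (fun (a b : g.Site) => B₀ * (N + N' * Real.exp (δ₀ * ρ) * Cℓ * κ.kCLt) * g.len a * 1 *
        Real.exp (-(δ₀ * g.dist a b))) := by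
    rw [hsumD]
    refine hasMajorantHom_mono (g := toB6 g R H) 𝔬.blkY 𝔬.blk
      (hasMajorantHom_fintypeSum 𝔬.blkY 𝔬.blk (fun i => (mulOp (𝔬.h i) * 𝔬.Gsq U i * mulOp (𝔬.h i)) ∘ₗ 𝔬.Dstar U) _
        hcube3) fun (a b : g.Site) => ?_
    have h1 : 0 ≤ B₀ * g.len a := mul_nonneg hB₀ (hlen a)
    have h2 : 0 ≤ B₀ * Real.exp (δ₀ * ρ) * Cℓ * κ.kCLt * g.len a :=
      mul_nonneg (mul_nonneg (mul_nonneg (mul_nonneg hB₀ (Real.exp_nonneg _)) hCℓ0) hκ.nonneg.kCLt) (hlen a)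
    calc (∑ i, ((if a ∈ 𝔬.S i then (1 : ℝ) else 0) * (B₀ * g.len a) +
            (if b ∈ 𝔬.S' i then (1 : ℝ) else 0) * (B₀ * Real.exp (δ₀ * ρ) * Cℓ * κ.kCLt * g.len a)) *
            Real.exp (-(δ₀ * g.dist a b)))
        = ((∑ i, if a ∈ 𝔬.S i then (1 : ℝ) else 0) * (B₀ * g.len a) +
            (∑ i, if b ∈ 𝔬.S' i then (1 : ℝ) else 0) * (B₀ * Real.exp (δ₀ * ρ) * Cℓ * κ.kCLt * g.len a)) *
            Real.exp (-(δ₀ * g.dist a b)) := by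
          simp only [Finset.sum_mul, add_mul, Finset.sum_add_distrib]
      _ ≤ (N * (B₀ * g.len a) + N' * (B₀ * Real.exp (δ₀ * ρ) * Cℓ * κ.kCLt * g.len a)) *
            Real.exp (-(δ₀ * g.dist a b)) :=
          mul_le_mul_of_nonneg_right (add_le_add (mul_le_mul_of_nonneg_right (hs.cnt a) h1)
            (mul_le_mul_of_nonneg_right (hs.cnt' b) h2)) (Real.exp_nonneg _)
      _ = B₀ * (N + N' * Real.exp (δ₀ * ρ) * Cℓ * κ.kCLt) * g.len a * 1 * Real.exp (-(δ₀ * g.dist a b)) := by ring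
  -- R♯ = Σ_a R♯_a has the scale-weighted majorant N_F·θ₀M⁻¹·L^jη(L^{j′}η)⁻¹·e^{−δ₀d}
  have hV : HasMajorant (g := toB6 g R H) 𝔬.blk (∑ a, 𝔬.Rt U a)
      (fun (y y' : g.Site) => NF * (θ₀ * g.M⁻¹) * g.len y * (g.len y')⁻¹ * Real.exp (-(δ₀ * g.dist y y'))) := by
    rw [← hasMajorantHom_iff (g := toB6 g R H) 𝔬.blk]
    refine hasMajorantHom_mono (g := toB6 g R H) 𝔬.blk 𝔬.blk
      (hasMajorantHom_fintypeSum 𝔬.blk 𝔬.blk (fun a => 𝔬.Rt U a) _ fun a =>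
        (hasMajorantHom_iff (g := toB6 g R H) 𝔬.blk _ _).mpr (hf.facT a)) fun (y y' : g.Site) => ?_
    have h3 : 0 ≤ (θ₀ * g.M⁻¹) * (g.len y * (g.len y')⁻¹) * Real.exp (-(δ₀ * g.dist y y')) :=
      mul_nonneg (mul_nonneg hθM (mul_nonneg (hlen y) (inv_nonneg.mpr (hlen y')))) (Real.exp_nonneg _)
    calc (∑ a, (if y' ∈ 𝔬.SF a then (1 : ℝ) else 0) * (θ₀ * g.M⁻¹) * (g.len y * (g.len y')⁻¹) *
            Real.exp (-(δ₀ * g.dist y y')))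
        = (∑ a, if y' ∈ 𝔬.SF a then (1 : ℝ) else 0) *
            ((θ₀ * g.M⁻¹) * (g.len y * (g.len y')⁻¹) * Real.exp (-(δ₀ * g.dist y y'))) := by
          rw [Finset.sum_mul]
          exact Finset.sum_congr rfl fun a _ => by ring
      _ ≤ NF * ((θ₀ * g.M⁻¹) * (g.len y * (g.len y')⁻¹) * Real.exp (-(δ₀ * g.dist y y'))) :=
          mul_le_mul_of_nonneg_right (hs.cntF y') h3
      _ = NF * (θ₀ * g.M⁻¹) * g.len y * (g.len y')⁻¹ * Real.exp (-(δ₀ * g.dist y y')) := by ring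
  have hGT : 𝔬.G U = (∑ i, mulOp (𝔬.h i) * 𝔬.Gsq U i * mulOp (𝔬.h i)) + (∑ a, 𝔬.Rt U a) * 𝔬.G U :=
    fixedPoint_of_388T hi.invT hi.eq3105T
  have hfixT : 𝔬.G U ∘ₗ 𝔬.Dstar U = (∑ i, mulOp (𝔬.h i) * 𝔬.Gsq U i * mulOp (𝔬.h i)) ∘ₗ 𝔬.Dstar U +
      (∑ a, 𝔬.Rt U a) ∘ₗ (𝔬.G U ∘ₗ 𝔬.Dstar U) := by
    conv_lhs => rw [hGT]
    rw [LinearMap.add_comp, Module.End.mul_eq_comp, LinearMap.comp_assoc]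
  have htransfer : ∀ a b : g.Site, (1 : ℝ) ≤ 1 * 1 * Real.exp (α * δ₀ * g.dist a b) := fun a b => by
    rw [one_mul, one_mul]
    exact Real.one_le_exp (mul_nonneg hαδ (hs.dnn a b))
  have hA3 : 0 ≤ B₀ * (N + N' * Real.exp (δ₀ * ρ) * Cℓ * κ.kCLt) :=
    mul_nonneg hB₀ (add_nonneg hN (mul_nonneg (mul_nonneg hN'e hCℓ0) hκ.nonneg.kCLt))
  have e3 := hom_majorant_of_leftFixedPoint_weighted (g := toB6 g R H) 𝔬.blk 𝔬.blkY d δ₀ α (NF * (θ₀ * g.M⁻¹))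
    (B₀ * (N + N' * Real.exp (δ₀ * ρ) * Cℓ * κ.kCLt)) 1 (fun y => g.len y) (fun _ => (1 : ℝ)) hA3 zero_le_one hs.lenpos
    (fun _ => zero_le_one) hθ hαδ hαδ2 htri hs.refl hs.symm hs.dnn h261 h263 hsmall htransfer hT₀ hV hfixT
  -- the comparisons of the four constants with A′ = B₀(N + N′e^{δ₀ρ}(C_ℓK))c₁
  have hA1 : 0 ≤ N * B₀ * B6.c1 d δ₀ α := mul_nonneg (mul_nonneg hN hB₀) hc1
  have hA1' : N * B₀ * B6.c1 d δ₀ α ≤ B₀ * (N + N' * Real.exp (δ₀ * ρ) * (Cℓ * K)) * B6.c1 d δ₀ α := by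
    have h1 : N ≤ N + N' * Real.exp (δ₀ * ρ) * (Cℓ * K) :=
      le_add_of_nonneg_right (mul_nonneg hN'e (mul_nonneg hCℓ0 hK))
    calc N * B₀ * B6.c1 d δ₀ α = N * (B₀ * B6.c1 d δ₀ α) := by ring
      _ ≤ (N + N' * Real.exp (δ₀ * ρ) * (Cℓ * K)) * (B₀ * B6.c1 d δ₀ α) :=
          mul_le_mul_of_nonneg_right h1 (mul_nonneg hB₀ hc1)
      _ = B₀ * (N + N' * Real.exp (δ₀ * ρ) * (Cℓ * K)) * B6.c1 d δ₀ α := by ring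
  have hA2 : 0 ≤ B₀ * (N + N' * Real.exp (δ₀ * ρ) * (κ.kPD + κ.kCD)) * B6.c1 d δ₀ α :=
    mul_nonneg (mul_nonneg hB₀ (add_nonneg hN (mul_nonneg hN'e hkD))) hc1
  have hA2' : B₀ * (N + N' * Real.exp (δ₀ * ρ) * (κ.kPD + κ.kCD)) * B6.c1 d δ₀ α ≤
      B₀ * (N + N' * Real.exp (δ₀ * ρ) * (Cℓ * K)) * B6.c1 d δ₀ α :=
    constA_le' hB₀ hN'e hc1 (hκ.leibD.trans hKCℓ)
  have hA4 : 0 ≤ B₀ * (N + N' * Real.exp (δ₀ * ρ) * (κ.kPL + κ.kCL)) * B6.c1 d δ₀ α :=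
    mul_nonneg (mul_nonneg hB₀ (add_nonneg hN (mul_nonneg hN'e hkL))) hc1
  have hA4' : B₀ * (N + N' * Real.exp (δ₀ * ρ) * (κ.kPL + κ.kCL)) * B6.c1 d δ₀ α ≤
      B₀ * (N + N' * Real.exp (δ₀ * ρ) * (Cℓ * K)) * B6.c1 d δ₀ α :=
    constA_le' hB₀ hN'e hc1 (hκ.leibL.trans hKCℓ)
  have hA3c : 0 ≤ B₀ * (N + N' * Real.exp (δ₀ * ρ) * Cℓ * κ.kCLt) * B6.c1 d δ₀ α := mul_nonneg hA3 hc1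
  have hA3' : B₀ * (N + N' * Real.exp (δ₀ * ρ) * Cℓ * κ.kCLt) * B6.c1 d δ₀ α ≤
      B₀ * (N + N' * Real.exp (δ₀ * ρ) * (Cℓ * K)) * B6.c1 d δ₀ α := by
    have h := constA_le' (N := N) hB₀ hN'e hc1 (mul_le_mul_of_nonneg_left hκ.leibT hCℓ0)
    calc B₀ * (N + N' * Real.exp (δ₀ * ρ) * Cℓ * κ.kCLt) * B6.c1 d δ₀ α
        = B₀ * (N + N' * Real.exp (δ₀ * ρ) * (Cℓ * κ.kCLt)) * B6.c1 d δ₀ α := by ring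
      _ ≤ B₀ * (N + N' * Real.exp (δ₀ * ρ) * (Cℓ * K)) * B6.c1 d δ₀ α := h
  refine ⟨?_, ?_, ?_, ?_⟩
  · refine hasMajorant_mono (g := toB6 g R H) 𝔬.blk e1 fun a b => ?_
    calc N * B₀ * B6.c1 d δ₀ α * (1 - NF * (θ₀ * g.M⁻¹) * B6.c1 d δ₀ α)⁻¹ * g.len a ^ 2 *
          Real.exp (-((1 - α) * δ₀ * g.dist a b))
        ≤ 2 * (B₀ * (N + N' * Real.exp (δ₀ * ρ) * (Cℓ * K)) * B6.c1 d δ₀ α) * g.len a ^ 2 *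
            Real.exp (-((1 - 2 * α) * δ₀ * g.dist a b)) :=
          weaken' hA1 hA1' hq (sq_nonneg _) (Real.exp_nonneg _) (hexp a b)
      _ = _ := hfin _ _
  · refine hasMajorantHom_mono (g := toB6 g R H) 𝔬.blk 𝔬.blkY e2 fun a b => ?_
    calc B₀ * (N + N' * Real.exp (δ₀ * ρ) * (κ.kPD + κ.kCD)) * B6.c1 d δ₀ α *
          (1 - NF * (θ₀ * g.M⁻¹) * B6.c1 d δ₀ α)⁻¹ * g.len a * Real.exp (-((1 - α) * δ₀ * g.dist a b))
        ≤ 2 * (B₀ * (N + N' * Real.exp (δ₀ * ρ) * (Cℓ * K)) * B6.c1 d δ₀ α) * g.len a *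
            Real.exp (-((1 - 2 * α) * δ₀ * g.dist a b)) :=
          weaken' hA2 hA2' hq (hlen a) (Real.exp_nonneg _) (hexp a b)
      _ = _ := hfin _ _
  · refine hasMajorantHom_mono (g := toB6 g R H) 𝔬.blkY 𝔬.blk e3 fun a b => ?_
    calc B₀ * (N + N' * Real.exp (δ₀ * ρ) * Cℓ * κ.kCLt) * 1 * B6.c1 d δ₀ α *
          (1 - NF * (θ₀ * g.M⁻¹) * B6.c1 d δ₀ α)⁻¹ * g.len a * (fun _ => (1 : ℝ)) b *
          Real.exp (-((1 - 2 * α) * δ₀ * g.dist a b))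
        = B₀ * (N + N' * Real.exp (δ₀ * ρ) * Cℓ * κ.kCLt) * B6.c1 d δ₀ α *
            (1 - NF * (θ₀ * g.M⁻¹) * B6.c1 d δ₀ α)⁻¹ * g.len a * Real.exp (-((1 - 2 * α) * δ₀ * g.dist a b)) := by
          ring
      _ ≤ 2 * (B₀ * (N + N' * Real.exp (δ₀ * ρ) * (Cℓ * K)) * B6.c1 d δ₀ α) * g.len a *
            Real.exp (-((1 - 2 * α) * δ₀ * g.dist a b)) :=
          weaken' hA3c hA3' hq (hlen a) (Real.exp_nonneg _) le_rfl
      _ = _ := hfin _ _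
  · refine hasMajorantHom_mono (g := toB6 g R H) 𝔬.blk 𝔬.blk e4 fun a b => ?_
    calc B₀ * (N + N' * Real.exp (δ₀ * ρ) * (κ.kPL + κ.kCL)) * B6.c1 d δ₀ α *
          (1 - NF * (θ₀ * g.M⁻¹) * B6.c1 d δ₀ α)⁻¹ * (fun _ => (1 : ℝ)) a *
          Real.exp (-((1 - α) * δ₀ * g.dist a b))
        ≤ 2 * (B₀ * (N + N' * Real.exp (δ₀ * ρ) * (Cℓ * K)) * B6.c1 d δ₀ α) * (fun _ => (1 : ℝ)) a *
            Real.exp (-((1 - 2 * α) * δ₀ * g.dist a b)) :=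
          weaken' hA4 hA4' hq zero_le_one (Real.exp_nonneg _) (hexp a b)
      _ = const37 d δ₀ α ρ B₀ N N' Cℓ K * Real.exp (-((1 - 2 * α) * δ₀ * g.dist a b)) := by
          simp only [const37]
          ring

omit [Fintype g.Site] [DecidableEq g.Site] in
/-- Arithmetic of «for M sufficiently large»: M ≧ 2N_Fθ₀c₁ gives N_F·θ₀M⁻¹·c₁ ≦ ½. [folklore] -/
private theorem small_of_threshold' {NF θ₀ c M : ℝ} (hM : 0 < M) (hbig : 2 * NF * θ₀ * c ≤ M) :
    NF * (θ₀ * M⁻¹) * c ≤ 1 / 2 := by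
  have h1 : NF * (θ₀ * M⁻¹) * c = (NF * θ₀ * c) / M := by
    rw [div_eq_mul_inv]
    ring
  rw [h1, div_le_iff₀ hM]
  linarith

end OneMember

/-! ## §3 The whole printed leaf over the direction letters -/

section Family

variable {I : Type} {c35 : ℝ} {geo : I → B9.Geometry} {bg : I → B9.Backgrounds}
variable [∀ i, Fintype (geo i).Site] [∀ i, DecidableEq (geo i).Site]
variable {X Y ι A Dir : I → Type} [∀ i, Fintype (X i)] [∀ i, DecidableEq (X i)] [∀ i, Fintype (Y i)]
  [∀ i, DecidableEq (Y i)] [∀ i, Fintype (ι i)] [∀ i, Fintype (A i)] [∀ i, Fintype (Dir i)]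

/-- ★ **(v2, R1′-A: `h36 ∋ Local342G ∧ Factors389 ∧ DirSupSq310 ∧ Identities310₂`; via the generic `thm310Printed_of_parts` BY NAME and `conv3107_of_local3107₂`.) THEOREM 3.10 AS THE WHOLE PRINTED LEAF `B9.Thm310Printed`** (pp. 415–416: *"For M sufficiently large, and a
configuration U satisfying (3.35), the operator G has the expansion G = Σ_ω R₀(X₀)R_{α₁}(X₁)·⋯·R_{αₙ}(Xₙ), (3.107) … A term in
this expansion, corresponding to a walk ω, depends on configuration U restricted to X̃⁵₀ ∪ X̃⁵₁ ∪ … ∪ X̃⁵ₙ, satisfies the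
inequality (3.108) … From (3.108) it follows that the expansion (3.107) is convergent in all norms in the inequalities
(3.42)–(3.47)."*), INHABITED at the sup-block pin `W310OfOps (𝔬 i) (rd i) (Conv3107 (𝔬 i) (R i) (H i) C δ)` with the explicit constants
C = `const37 d δ₀ α ρ B₀ N N' Cℓ K`, δ = (1 − 2α)δ₀ (convergence), δ₀′ = 2(1 − α)δ₀, O(1) = B₀, c = θ₀c₁(α) + 1 (the bound
(3.108)) — from, per member and per U under the printed provisos of Corollary 3.6 (M ≧ M₁, 0 < α₀, O(1)Mα₀ ≦ a₁, U satisfying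
(3.35) = `Reg335 c35 α₀ U`): «Cor. 3.6 for all G_□(U)» (`Local342G`), the (3.89)-type factor bounds (`Factors389`) and the
structure of the expansion over the direction letters (`Identities310₂`, `DirSupSq310`); per member: the static data (`StaticOK310`), the Leibniz sizes (`Sizes310.Bounded`),
the readings (`WalkReading310.OK`), the locality inputs (`Locality310`), and [4] Lemma 2.1 (2.61) at the exponent α for
M ≧ M_L.  The printed quantifiers are met with M₂ := max(M₁, M_L, 2N_Fθ₀c₁(α)) and a₀ := a₁ ∕ O(1) (O(1) = `c35`, the
geometric factor of (3.35)).  Nothing of print asserted (all inputs are hypotheses of printed shape); the sup block (3.42) of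
«all norms» only; NOT a node discharge.
[cite: Balaban1985BackgroundPropagators, Thm 3.10 (3.105)–(3.108) pp.414–416 + Cor. 3.6 p.408 + (3.35) p.396; Balaban1984PropagatorsII, Lemma 2.1 (2.61) p.234 + Prop 2.2 p.234] -/
theorem thm310Printed_of_local3107₂ (𝔬 : ∀ i, Ops310 (geo i) (bg i) (X i) (Y i) (ι i) (A i))
    (𝔡 : ∀ i, DirOps310 (𝔬 i) (Dir i)) (𝔩 : ∀ i, DirLetters310 (𝔬 i) (Dir i))
    (rd : ∀ i, WalkReading310 (geo i) (bg i) (X i) (ι i) (A i)) (R : I → ℝ) (H : I → Prop) (κ : I → Sizes310)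
    (d : ℕ) (α ρ N N' NF Cℓ K θ₀ B₀ δ₀ a₁ M₁ ML : ℝ)
    (hc : 0 < c35) (hα : 0 ≤ α) (hα2 : α ≤ 1 / 2) (hN : 0 ≤ N) (hN' : 0 ≤ N') (hNF : 0 ≤ NF) (hCℓ : 1 ≤ Cℓ)
    (hK : 0 ≤ K) (hθ₀ : 0 ≤ θ₀) (hB₀ : 0 < B₀) (hδ₀ : 0 < δ₀) (ha₁ : 0 < a₁) (hM₁ : 0 < M₁)
    (hst : ∀ i, StaticOK310 (𝔬 i) ρ N N' NF Cℓ (κ i)) (hκ : ∀ i, (κ i).Bounded K)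
    (hrd : ∀ i, (rd i).OK (𝔬 i).blk) (hloc : ∀ i, Locality310 (𝔬 i) (rd i))
    (h261 : ∀ i, ML ≤ (geo i).M → Ineq261 d (toB6 (geo i) (R i) (H i)) δ₀ α)
    (h36 : ∀ i, M₁ ≤ (geo i).M → ∀ α₀ : ℝ, 0 < α₀ → c35 * (geo i).M * α₀ ≤ a₁ →
      ∀ U : (bg i).Cfg, (bg i).Reg335 c35 α₀ U →
        Local342G (𝔬 i) (R i) (H i) B₀ δ₀ U ∧ Factors389 (𝔬 i) (R i) (H i) θ₀ δ₀ U ∧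
          DirSupSq310 (𝔬 i) (𝔡 i) (R i) (H i) U ∧ Identities310₂ (𝔬 i) (𝔡 i) (𝔩 i) (R i) (H i) U) :
    B9.Thm310Printed c35 geo bg
      (fun i => W310OfOps (𝔬 i) (rd i)
        (Conv3107 (𝔬 i) (R i) (H i) (const37 d δ₀ α ρ B₀ N N' Cℓ K) ((1 - 2 * α) * δ₀))) := by
  refine thm310Printed_of_parts 𝔬 rd _ R H κ d α ρ N N' NF Cℓ θ₀ B₀ δ₀ a₁ M₁ ML
    (max M₁ (max ML (2 * NF * θ₀ * B6.c1 d δ₀ α))) hc hα (by linarith) hθ₀ hB₀ hδ₀ ha₁ hM₁ hst hrd hloc h261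
    (fun i hM α₀ hα₀ ha U hU => ?_) (fun i hM α₀ hα₀ ha U hU => ?_)
  · have hM₁i : M₁ ≤ (geo i).M := le_trans (le_max_left _ _) hM
    have hMLi : ML ≤ (geo i).M := le_trans (le_trans (le_max_left _ _) (le_max_right _ _)) hM
    have hbig : 2 * NF * θ₀ * B6.c1 d δ₀ α ≤ (geo i).M := le_trans (le_trans (le_max_right _ _) (le_max_right _ _)) hM
    have hMpos : 0 < (geo i).M := lt_of_lt_of_le hM₁ hM₁i
    obtain ⟨hl, hf, hT, hi⟩ := h36 i hM₁i α₀ hα₀ ha U hU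
    have hq : NF * (θ₀ * (geo i).M⁻¹) * B6.c1 d δ₀ α ≤ 1 / 2 := small_of_threshold' hMpos hbig
    exact conv3107_of_local3107₂ (𝔬 i) (𝔡 i) (𝔩 i) (R i) (H i) d δ₀ α ρ B₀ N N' NF Cℓ K θ₀ (κ i) U hB₀.le hδ₀.le hα hα2 hN hN'
      hNF hCℓ hK hθ₀ hMpos (hst i) (hκ i) (h261 i hMLi) hq hl hf hT hi
  · obtain ⟨hl, hf, -, -⟩ := h36 i hM α₀ hα₀ ha U hU
    exact ⟨hl, hf⟩

end Family

end

end Literature.MathematicalPhysics.QuantumFieldTheory.Balaban1983to89.B9Thm310WholeDir
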